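import Mathlib
import Literature.NumberTheory.Automorphic.BCDTModularity
import Literature.NumberTheory.Automorphic.CDTTheorem722
import Literature.NumberTheory.GaloisRepresentations.AdequateSubgroup
import Literature.NumberTheory.GaloisRepresentations.ChebotarevOpenSubgroup

/-!
# Stub ideas k2 GEN 16 for `stub_liftFive` (crux `FreyModularity`, route `DefiniteXi`) — companion

FAMILY 2 — RESHAPE.  GEN 15 (`STUB_IDEAS_stub_liftFive_2g15.lean`, technique T-δ) re-typed the three
cohomological inputs (A) `H¹(G, W) = 0`, (B) `W^G = 0`, (C) "Chebotarev supply" of DDT Thm. 2.49 at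
`ℓ = 5` as FINITE-GROUP statements about `G = im ρ̄ ≤ GL₂(𝔽₅)` acting on `W = M₂(𝔽₅)(1)`.
GEN 16 completes T-δ to the GALOIS LEVEL — the form the `R = T` engine seat consumes — using that
Chebotarev is PROVED in the tree (`exists_isArithFrobAt_mul_inv_mem_not_mem`, sorry-free):

* **T-δ′ (strengthen-to-simplify).** DDT 2.49 (c) is stated SELMER-FREE and POINTWISE: every
  continuous twisted `1`-cocycle `ψ : Γ_ℚ → 𝔰𝔩₂(𝔽₅)(1)` (w.r.t. `ρ̄ = ρ̄_{E,5}`) that is not a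
  coboundary is killed by a Taylor–Wiles prime `q ≡ 1 (5ⁿ)`, `q ∉ S`, `ρ̄(Frob_q)` with distinct
  eigenvalues, i.e. `ψ(Frob_q) ∉ (Frob_q - 1) W` (`= res_q ψ ≠ 0` in `H¹(𝔽_q, W)`), with `ρ̄` AND `ψ`
  unramified at `q` for free (inertia lands in the open normal subgroup fed to Chebotarev).  No
  Selmer groups, no local conditions, no `F_n = \bar ℚ^{ker ρ̄}(ζ_{5ⁿ})` as a field: the level-`n`
  subgroup is `{σ | ρ̄ σ = 1, ψ σ = 0, σ|μ_{5ⁿ} = id}` and "`σ₀ ∈ Gal(F_n/ℚ(ζ_{5ⁿ}))`" becomes the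
  POWER MAP `τ ↦ τ^{5ⁿ}` on `Γ_{ℚ(ζ₅)} = {det ρ̄ = 1}` (KG1/KG2), whose image in `G ∩ SL₂(𝔽₅)` still
  contains g15's semisimple spanning set (L8: `d, s, ds` have order `4 ∣ 5ᵏ - 1`; regime `5 ∤ |G|`:
  the power map is a bijection) — so NO index / normal-subgroup bookkeeping and no perfectness of
  `SL₂(𝔽₅)` is needed.  `tr² - 4 det` is invariant under `A ↦ A⁵` on `M₂(𝔽₅)` (L12, kernel-decided).
* **Quantifier order.** Pointwise killing ⇒ a killing SET of `≤ dim` primes by greedy linear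
  algebra (K6); padding to `|Q| = r` uses X7₅.

Helper statements (sizes in the memo; `sorry` = to be proved; L12, L12′, K0 are proved here):
* §0 copies of the g15 carriers `twAd`, `IsTwCocycle`, `IsTwCoboundary`, `TwH1Vanishes`,
  `DetSurjective`, `detOneMatrices`, `sqDetMatrices` (self-contained file; same texts).
* §1 K0/K3/K4/K2b/K12 — cocycles on an abstract group `Γ` along `π : Γ →* GL₂(𝔽₅)`:
  inflation–restriction in explicit form (`K12`: a cocycle vanishing on `N ≥ [Γ, ker π]` is a
  coboundary, from (A)+(B) for `im π`).
* §2 L12 (decide) `tr/det (A⁵) = tr/det A`; L6n the level-`5ᵏ` group supply; `not_mem_range_twAd_sub`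
  (semisimple `p`: `ker (Ad p - 1) ∩ im (Ad p - 1) = 0`); K6 = pointer to k2-liftThree-g6 A1.
* §3 KG1–KG4, K5 — `μ_{5ⁿ}` bookkeeping in `Γ_ℚ`, Frobenius ⇒ `q ≡ 1 (5ⁿ)`, the open normal level
  subgroup; B1 the bridge from the stub's binders (g15 B0 + Σ).
* §4 X7g₅, X7₅ (TW primes (a)(b) at `ℓ = 5`), TW-KILL₅ (the killing clause (c), pointwise).
-/

noncomputable section

namespace Summit.ABC.ABC.Cruxes.FreyModularity.StubIdeas.LiftFive2g16

open scoped MatrixGroups NumberField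
open Matrix Field IsDedekindDomain NumberField
open Literature.NumberTheory.EllipticCurves
open Literature.NumberTheory.Automorphic
open Literature.NumberTheory.GaloisRepresentations
open WeierstrassCurve Rat.HeightOneSpectrum

/-- `𝔽₅`. -/
abbrev F5 := ZMod 5
/-- `M₂(𝔽₅)`. -/
abbrev M2 := Matrix (Fin 2) (Fin 2) (ZMod 5)
/-- `GL₂(𝔽₅)`. -/
abbrev G5 := GL (Fin 2) (ZMod 5)

/-! ### §0 — carriers copied from the GEN-15 companion (identical texts) -/

/-- `ad ρ̄(1)`-action of `GL₂(𝔽₅)` on `M₂(𝔽₅)`: `g • X = det g · g X g⁻¹`. -/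
def twAd (g : G5) (X : M2) : M2 :=
  ((Matrix.GeneralLinearGroup.det g : (ZMod 5)ˣ) : ZMod 5) • ((g : M2) * X * ((g⁻¹ : G5) : M2))

/-- Inhomogeneous `1`-cocycle `f : H → M₂(𝔽₅)(1)`: `f (g h) = g • f h + f g`. -/
def IsTwCocycle (H : Subgroup G5) (f : H → M2) : Prop :=
  ∀ g h : H, f (g * h) = twAd (g : G5) (f h) + f g

/-- `1`-coboundary: `f g = g • m - m`. -/
def IsTwCoboundary (H : Subgroup G5) (f : H → M2) : Prop :=
  ∃ m : M2, ∀ g : H, f g = twAd (g : G5) m - m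

/-- `H¹(H, M₂(𝔽₅)(1)) = 0` in explicit form. -/
def TwH1Vanishes (H : Subgroup G5) : Prop :=
  ∀ f : H → M2, IsTwCocycle H f → IsTwCoboundary H f

/-- `det : H → 𝔽₅ˣ` is onto. -/
def DetSurjective (H : Subgroup G5) : Prop :=
  ∀ d : (ZMod 5)ˣ, ∃ g : H, Matrix.GeneralLinearGroup.det (g : G5) = d

/-- Matrices of the `det = 1` part of `H`. -/
def detOneMatrices (H : Subgroup G5) : Set M2 :=
  (fun g : G5 => (g : M2)) '' {g : G5 | g ∈ H ∧ Matrix.GeneralLinearGroup.det g = 1}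

/-- Matrices of the `det = ±1` part of `H`. -/
def sqDetMatrices (H : Subgroup G5) : Set M2 :=
  (fun g : G5 => (g : M2)) '' {g : G5 | g ∈ H ∧ Matrix.GeneralLinearGroup.det g ^ 2 = 1}

/-- Distinct eigenvalues (in `𝔽₂₅`) of a `2 × 2` matrix over `𝔽₅`: `tr² ≠ 4 det`. -/
def HasDistinctEigenvalues (A : M2) : Prop :=
  A.trace ^ 2 ≠ 4 * A.det

/-! ### §1 — twisted cocycles along a homomorphism `π : Γ →* GL₂(𝔽₅)` (K0, K3, K4, K2b, K12) -/

/-- `1`-cocycle on an abstract group `Γ` for the action pulled back along `π`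
(`Γ = Γ_ℚ`, `π = ρ̄`): `f (g h) = π g • f h + f g`. -/
def IsTwCocycleHom {Γ : Type*} [Group Γ] (π : Γ →* G5) (f : Γ → M2) : Prop :=
  ∀ g h : Γ, f (g * h) = twAd (π g) (f h) + f g

/-- `1`-coboundary along `π`: `f g = π g • m - m`. -/
def IsTwCoboundaryHom {Γ : Type*} [Group Γ] (π : Γ →* G5) (f : Γ → M2) : Prop :=
  ∃ m : M2, ∀ g : Γ, f g = twAd (π g) m - m

/-- **K0a.** `1 • X = X`. -/
theorem twAd_one (X : M2) : twAd 1 X = X := by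
  simp [twAd]

/-- **K0b.** A cocycle vanishes at `1`. -/
theorem map_one_of_isTwCocycleHom {Γ : Type*} [Group Γ] {π : Γ →* G5} {f : Γ → M2}
    (hf : IsTwCocycleHom π f) : f 1 = 0 := by
  have h := hf 1 1
  rw [mul_one, map_one, twAd_one] at h
  have h2 : f 1 + f 1 = f 1 + 0 := by rw [add_zero]; exact h.symm
  exact add_left_cancel h2

/-- **K0c.** On `ker π` a cocycle is additive: `f (σ τ) = f τ + f σ` for `π σ = 1`. -/
theorem map_mul_of_map_eq_one {Γ : Type*} [Group Γ] {π : Γ →* G5} {f : Γ → M2}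
    (hf : IsTwCocycleHom π f) (σ τ : Γ) (hσ : π σ = 1) : f (σ * τ) = f τ + f σ := by
  rw [hf σ τ, hσ, twAd_one]

/-- **K3 (S).** Conjugation formula on `ker π`: `f (γ σ γ⁻¹) = π γ • f σ` for `π σ = 1`
(expand `f (γ σ γ⁻¹)` twice and use `f γ⁻¹ = -(π γ)⁻¹ • f γ`).  Hence `f|_{ker π}` is a
`Γ`-equivariant homomorphism and its image spans a `Γ`-stable subspace (K4). [folklore] -/
theorem map_conj_of_map_eq_one {Γ : Type*} [Group Γ] {π : Γ →* G5} {f : Γ → M2}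
    (hf : IsTwCocycleHom π f) (γ σ : Γ) (hσ : π σ = 1) :
    f (γ * σ * γ⁻¹) = twAd (π γ) (f σ) := by
  have h1 := hf (γ * σ) γ⁻¹
  have h2 := hf γ σ
  have h3 := hf γ γ⁻¹
  rw [mul_inv_cancel, map_one_of_isTwCocycleHom hf] at h3
  rw [map_mul, hσ, mul_one] at h1
  rw [h1, h2, eq_neg_of_add_eq_zero_left h3.symm]
  abel

/-- **K4 (S).** For `N ⊴ Γ` inside `ker π`, the span of `f(N)` is stable under `π(Γ)` (from K3).
[folklore] -/
theorem twAd_mem_span_image {Γ : Type*} [Group Γ] {π : Γ →* G5} {f : Γ → M2}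
    (hf : IsTwCocycleHom π f) (N : Subgroup Γ) [N.Normal] (hN : N ≤ π.ker) (γ : Γ) (X : M2)
    (hX : X ∈ Submodule.span (ZMod 5) (f '' (N : Set Γ))) :
    twAd (π γ) X ∈ Submodule.span (ZMod 5) (f '' (N : Set Γ)) := by
  sorry

/-- **K2b (XS–S).** (B) for all of `M₂(𝔽₅)(1)` from (B) on the trace-zero part plus `det` onto:
write `X = X₀ + c·1` (`2 ∈ 𝔽₅ˣ`); `twAd` preserves the splitting; a scalar `c·1` is moved to
`det g · c · 1`, and some `g ∈ G` has `det g = 2 ≠ 1`. [folklore] -/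
theorem twInvariants_eq_zero_of_detSurjective (G : Subgroup G5) (hdet : DetSurjective G)
    (htr : ∀ X : M2, X.trace = 0 → (∀ g : G, twAd (g : G5) X = X) → X = 0)
    (X : M2) (hX : ∀ g : G, twAd (g : G5) X = X) : X = 0 := by
  sorry

/-- **K12 (S–M) — inflation–restriction, explicit.**  Let `N ≤ ker π` contain every commutator
`[γ, z]` with `z ∈ ker π` (so `ker π / N` is central in `Γ / N`).  If (A) `H¹(im π, M₂(𝔽₅)(1)) = 0`
and (B) `M₂(𝔽₅)(1)^{im π} = 0`, every cocycle `f` vanishing on `N` is a coboundary.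
Proof: for `z ∈ ker π`, `γ ∈ Γ`: `f(γz) = π γ • f z + f γ`, `f(zγ) = f γ + f z` and `γ z = n z γ`
with `n ∈ N`, `f(n z γ) = f(z γ)`; so `π γ • f z = f z`, hence `f z = 0` by (B); then `f` is constant
on `ker π`-cosets, descends to a cocycle on `im π ≅ Γ / ker π`, which is a coboundary by (A).
(DDT p. 83–84: `H¹(Gal(F_n/ℚ), ad⁰ρ̄(1)) = 0` via `Gal(F_n/F_0)` central `ℓ`-power acting trivially
— here without the `ℓ`-group hypothesis, which is not needed.)
[cite: DarmonDiamondTaylor1995, Thm. 2.49 (proof, p. 84)] -/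
theorem isTwCoboundaryHom_of_forall_mem_eq_zero {Γ : Type*} [Group Γ] (π : Γ →* G5)
    (N : Subgroup Γ) (hN : N ≤ π.ker) (hcomm : ∀ γ z : Γ, π z = 1 → γ * z * γ⁻¹ * z⁻¹ ∈ N)
    (hA : TwH1Vanishes π.range)
    (hB : ∀ X : M2, (∀ g : π.range, twAd (g : G5) X = X) → X = 0)
    (f : Γ → M2) (hf : IsTwCocycleHom π f) (hfN : ∀ z ∈ N, f z = 0) :
    IsTwCoboundaryHom π f := by
  sorry

/-! ### §2 — finite-group supply at level `5ᵏ` (L12, L6n), semisimplicity, greedy (K6) -/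

/-- **L12 (decide).** On `M₂(𝔽₅)`, `tr (A⁵) = tr A` and `det (A⁵) = det A` (Frobenius on the
eigenvalues; pencil proof: Cayley–Hamilton gives `tr A⁵ = t⁵ - 5t³d + 5td² = t⁵ = t`). -/
theorem trace_det_pow_five (A : M2) : (A ^ 5).trace = A.trace ∧ (A ^ 5).det = A.det := by
  have h : ∀ a b c d : ZMod 5,
      (((!![a, b; c, d] : M2) ^ 5).trace = (!![a, b; c, d] : M2).trace ∧
        ((!![a, b; c, d] : M2) ^ 5).det = (!![a, b; c, d] : M2).det) := by
    decide +kernel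
  have := h (A 0 0) (A 0 1) (A 1 0) (A 1 1)
  rwa [← Matrix.eta_fin_two A] at this

/-- **L12′.** Hence `tr`, `det` — so `tr² - 4 det` and `HasDistinctEigenvalues` — are invariant
under `A ↦ A^{5ᵏ}`: the reason `τ ↦ τ^{5ᵏ}` (KG1) costs nothing on the `GL₂(𝔽₅)` side. -/
theorem trace_det_pow_five_pow (A : M2) (k : ℕ) :
    (A ^ 5 ^ k).trace = A.trace ∧ (A ^ 5 ^ k).det = A.det := by
  induction k with
  | zero => simp
  | succ k ih =>
    rw [pow_succ, pow_mul]
    exact ⟨(trace_det_pow_five _).1.trans ih.1, (trace_det_pow_five _).2.trans ih.2⟩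

/-- **L12″.** `HasDistinctEigenvalues` is invariant under `g ↦ g^{5ᵏ}` in `GL₂(𝔽₅)`. -/
theorem hasDistinctEigenvalues_pow_iff (g : G5) (k : ℕ) :
    HasDistinctEigenvalues (((g ^ 5 ^ k : G5)) : M2) ↔ HasDistinctEigenvalues (g : M2) := by
  unfold HasDistinctEigenvalues
  rw [Units.val_pow_eq_pow_val, (trace_det_pow_five_pow (g : M2) k).1,
    (trace_det_pow_five_pow (g : M2) k).2]

/-- **L6n-b (S–M) — group half of the TW-prime supply (b).**  `det` onto and the `det = ±1` part
spanning `M₂(𝔽₅)` (the consumer's provable shape, B1) give `g ∈ G` with `det g = 1` and distinct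
eigenvalues: regime `5 ∣ |G|` ⇒ `G = GL₂(𝔽₅) ∋ diag(2,3)` (g15 L2, L8); regime `5 ∤ |G|` ⇒ the
`det = 1` part spans (g15 L7), so contains a non-scalar element, semisimple (order prime to `5`),
hence with distinct eigenvalues. [cite: DarmonDiamondTaylor1995, Thm. 2.49 (proof, p. 84)] -/
theorem exists_detOne_hasDistinctEigenvalues (G : Subgroup G5) (hdet : DetSurjective G)
    (hsq : Submodule.span (ZMod 5) (sqDetMatrices G) = ⊤) :
    ∃ g : G, Matrix.GeneralLinearGroup.det (g : G5) = 1 ∧ HasDistinctEigenvalues ((g : G5) : M2) := by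
  sorry

/-- **L6n-c (M) — group half of the killing clause (c) at level `5ᵏ`.**  Same hypotheses; for every
non-zero `G`-stable subspace `V` of trace-zero matrices there are `g ∈ G`, `det g = 1`, such that
`p = g^{5ᵏ}` has distinct eigenvalues and commutes with some `X ∈ V ∖ 0`.  Regime `G = GL₂(𝔽₅)`:
`{d, s, ds}^{5ᵏ} = {d, s, ds}` up to sign pattern (orders `4 ∣ 5ᵏ - 1`), a semisimple spanning set
with `1` (g15 L8), then g15 L6 `exists_noncentral_comm_of_semisimple_span`; regime `5 ∤ |G|`:
`g ↦ g^{5ᵏ}` is a bijection of `G ∩ SL₂` (`Nat.Coprime`, `powCoprime`), whose matrices span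
(g15 L7), then g15 L6 with `S =` that finite set.  This replaces DDT's "`σ₀ ∈ Gal(F_n/ℚ(ζ_{ℓⁿ}))`
… since `ρ̄|_{ℚ(ζ_{ℓⁿ})}` is absolutely irreducible" by the power map (no index bookkeeping).
[cite: DarmonDiamondTaylor1995, Thm. 2.49 (proof, p. 84)] -/
theorem exists_detOne_pow_comm (G : Subgroup G5) (hdet : DetSurjective G)
    (hsq : Submodule.span (ZMod 5) (sqDetMatrices G) = ⊤) (k : ℕ)
    (V : Submodule (ZMod 5) M2) (hV0 : V ≠ ⊥) (hVtr : ∀ X ∈ V, X.trace = 0)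
    (hVstab : ∀ g : G, ∀ X ∈ V, twAd (g : G5) X ∈ V) :
    ∃ g : G, Matrix.GeneralLinearGroup.det (g : G5) = 1 ∧
      HasDistinctEigenvalues ((((g : G5) ^ 5 ^ k : G5)) : M2) ∧
      ∃ X ∈ V, X ≠ 0 ∧
        (((g : G5) ^ 5 ^ k : G5) : M2) * X = X * (((g : G5) ^ 5 ^ k : G5) : M2) := by
  sorry

/-- **Semisimplicity (S).** If `p ∈ GL₂(𝔽₅)` has distinct eigenvalues and `det p = 1` (so
`twAd p = Ad p`), a non-zero `X` commuting with `p` is not of the form `p • Y - Y`: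
`Ad p` is semisimple (`p` diagonalisable over `𝔽₂₅`), so `ker (Ad p - 1) ∩ im (Ad p - 1) = 0`.
Cheaper route: `Y ↦ p • Y - Y` kills the `2`-dimensional centraliser `𝔽₅[p]` of `p` and has rank
`2`, and `tr (X Z) `-orthogonality: `im (Ad p - 1) ⊥ centraliser`, non-degenerate on it. [folklore] -/
theorem not_mem_range_twAd_sub (p : G5) (hp : HasDistinctEigenvalues (p : M2))
    (hdet : Matrix.GeneralLinearGroup.det p = 1) (X : M2) (hX0 : X ≠ 0)
    (hcomm : (p : M2) * X = X * (p : M2)) :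
    X ∉ Set.range (fun Y : M2 => twAd p Y - Y) := by
  sorry

/-- **K6 — pointwise killing ⇒ a killing set of `dim` primes (greedy).**  NOT re-filed: this is
exactly k2's `ℓ`-free pure-algebra lemma A1 `exists_finset_killing` of
`STUB_IDEAS_stub_liftThree_2g6.lean` (de Shalit Cor. 17 (ii) ⇒ Prop. 18), to be instantiated with
`P` = TW primes of level `n` (X7₅), `f q ψ = ψ(Frob_q) mod (Frob_q - 1) W` (TW-KILL₅).  Recorded here
only as a pointer. [cite: Cornell1997MFFLT, de Shalit Ch., Cor. 17 (ii), Prop. 18] -/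
theorem k6_pointer : True := trivial

/-! ### §3 — `μ_{5ⁿ}` bookkeeping in `Γ_ℚ`, Frobenius, the level subgroup (KG1–KG4, K5, B1) -/

/-- **KG3 (S).** Commutators of `Γ_ℚ` fix every root of unity (`Γ_ℚ` acts on the cyclic group
`μ_m(\bar ℚ)` through powers, `modularCyclotomicCharacter`; powers commute). [folklore] -/
theorem commutator_smul_eq_self (γ z : absoluteGaloisGroup ℚ) {m : ℕ} (hm : 0 < m)
    (ζ : AlgebraicClosure ℚ) (hζ : ζ ^ m = 1) : (γ * z * γ⁻¹ * z⁻¹) • ζ = ζ := by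
  sorry

/-- **KG1 (S–M).** If `τ` fixes `μ₅` then `τ^{5ᵏ}` fixes `μ_{5^{k+1}}`: `τ ζ = ζ^c` on a primitive
`5^{k+1}`-th root with `c ≡ 1 (5)` (test on `ζ^{5ᵏ} ∈ μ₅`), and `c^{5ᵏ} ≡ 1 (5^{k+1})`.
(= "`τ₀^{ℓ^{n-1}} ∈ Γ_{ℚ(ζ_{ℓⁿ})}`", the replacement for `Gal(F_n/ℚ(ζ_{ℓⁿ}))`.) [folklore] -/
theorem pow_smul_eq_self_of_smul_eq_self_five (τ : absoluteGaloisGroup ℚ)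
    (h5 : ∀ ζ : AlgebraicClosure ℚ, ζ ^ 5 = 1 → τ • ζ = ζ) (k : ℕ) (ζ : AlgebraicClosure ℚ)
    (hζ : ζ ^ 5 ^ (k + 1) = 1) : (τ ^ 5 ^ k) • ζ = ζ := by
  sorry

/-- **KG2 (S).** For `ρ̄ = W[5]` framed: `det ρ̄(σ) = 1 ↔ σ` fixes `μ₅` (`det ρ̄ = χ̄₅`, tree
`det_eq_modPCyclotomicCharacter_of_isTorsionGaloisRep_holds`; `modPCyclotomicCharacterZMod_spec`;
`modularCyclotomicCharacter.unique` for `←`). [folklore] -/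
theorem det_eq_one_iff_forall_smul_eq_self (W : WeierstrassCurve ℚ) [W.IsElliptic]
    {ρ : ModPGaloisRep ℚ (ZMod 5) 2} (hρ : W.IsTorsionGaloisRep 5 ρ) (σ : absoluteGaloisGroup ℚ) :
    Matrix.GeneralLinearGroup.det (ρ σ) = 1 ↔
      ∀ ζ : AlgebraicClosure ℚ, ζ ^ 5 = 1 → σ • ζ = ζ := by
  sorry

/-- **KG4 (S).** An arithmetic Frobenius at a prime above `q ≠ 5` fixing `μ_{5ⁿ}` forces
`q ≡ 1 (mod 5ⁿ)`: `φ ζ = ζ^q` on `μ_{5ⁿ}` (tree `smul_eq_pow_of_isArithFrobAt_rat`), a primitive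
`ζ_{5ⁿ} ∈ \bar ℚ` exists, `IsPrimitiveRoot.pow_eq_one_iff_dvd`. [folklore] -/
theorem modEq_one_of_isArithFrobAt {q : ℕ} (hq : q.Prime) (hq5 : q ≠ 5) (n : ℕ)
    {𝔓 : Ideal (absIntegers (𝓞 ℚ) ℚ)} (h𝔓 : 𝔓 ∈ (primesEquiv.symm ⟨q, hq⟩).primesAbove)
    {φ : absoluteGaloisGroup ℚ} (hφ : IsArithFrobAt (𝓞 ℚ) φ 𝔓)
    (hfix : ∀ ζ : AlgebraicClosure ℚ, ζ ^ 5 ^ n = 1 → φ • ζ = ζ) : q ≡ 1 [MOD 5 ^ n] := by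
  sorry

/-- **K5 (S–M) — the level subgroup.** For a continuous (locally constant) cocycle `ψ` along `ρ̄`,
`N_{ψ,n} = {σ | ρ̄ σ = 1, ψ σ = 0, σ|μ_{5ⁿ} = id}` is an OPEN NORMAL subgroup of `Γ_ℚ` (subgroup by
K0c; normal by K3; open: `ρ̄` continuous into discrete `GL₂(𝔽₅)`, `hψo`, and
`IntermediateField.fixingSubgroup_isOpen` for `ℚ(μ_{5ⁿ})`). [folklore] -/
theorem exists_levelSubgroup (ρ : ModPGaloisRep ℚ (ZMod 5) 2) (ψ : absoluteGaloisGroup ℚ → M2)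
    (hψ : IsTwCocycleHom ρ.toMonoidHom ψ) (hψo : IsOpen {σ : absoluteGaloisGroup ℚ | ψ σ = 0})
    (n : ℕ) :
    ∃ N : Subgroup (absoluteGaloisGroup ℚ), N.Normal ∧ IsOpen (N : Set (absoluteGaloisGroup ℚ)) ∧
      ∀ σ : absoluteGaloisGroup ℚ, σ ∈ N ↔
        ρ σ = 1 ∧ ψ σ = 0 ∧ ∀ ζ : AlgebraicClosure ℚ, ζ ^ 5 ^ n = 1 → σ • ζ = ζ := by
  sorry

/-- **B1 (S given g15) — bridge from the stub's binders to (A), (B), `det` onto, spanning.**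
`span (sqDetMatrices (im ρ̄)) = ⊤ ∧ DetSurjective (im ρ̄)` is g15 B0
(`span_sqDet_eq_top_of_isAbsIrreducibleOverSqrt`); (A) and trace-zero (B) are g15 Σ
(`ddt249_inputs_five`); full (B) by K2b. [cite: DarmonDiamondTaylor1995, Thm. 2.49] -/
theorem galois_inputs_five (W : WeierstrassCurve ℚ) [W.IsElliptic]
    {ρ : ModPGaloisRep ℚ (ZMod 5) 2} (hρ : W.IsTorsionGaloisRep 5 ρ)
    (hirr : ρ.IsAbsIrreducibleOverSqrt 5) :
    DetSurjective ρ.toMonoidHom.range ∧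
      Submodule.span (ZMod 5) (sqDetMatrices ρ.toMonoidHom.range) = ⊤ ∧
      TwH1Vanishes ρ.toMonoidHom.range ∧
      ∀ X : M2, (∀ g : ρ.toMonoidHom.range, twAd (g : G5) X = X) → X = 0 := by
  sorry

/-! ### §4 — DDT Thm. 2.49 at `ℓ = 5` for `ρ̄ = ρ̄_{E,5}`, Galois level (X7g₅, X7₅, TW-KILL₅) -/

/-- **X7g₅ (S given L6n-b, KG1, KG2).** For every `n` some `τ ∈ Γ_ℚ` fixes `μ_{5ⁿ}` and `ρ̄(τ)`
has distinct eigenvalues: `τ = τ₀^{5ⁿ}` with `ρ̄(τ₀) = g` from L6n-b (`det g = 1` ⇒ `τ₀` fixes `μ₅`,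
KG2; KG1; L12″). [cite: DarmonDiamondTaylor1995, Thm. 2.49 (a)(b)] -/
theorem exists_hasDistinctEigenvalues_fixing_zeta (W : WeierstrassCurve ℚ) [W.IsElliptic]
    {ρ : ModPGaloisRep ℚ (ZMod 5) 2} (hρ : W.IsTorsionGaloisRep 5 ρ)
    (hirr : ρ.IsAbsIrreducibleOverSqrt 5) (n : ℕ) :
    ∃ τ : absoluteGaloisGroup ℚ,
      (∀ ζ : AlgebraicClosure ℚ, ζ ^ 5 ^ n = 1 → τ • ζ = ζ) ∧
        HasDistinctEigenvalues ((ρ τ : G5) : M2) := by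
  sorry

/-- **X7₅ (M, provable now) — Taylor–Wiles prime supply (a)(b) at `ℓ = 5`.**  For every `n` and
finite `S` there is a good prime `q ∉ S`, `q ≠ 5`, `q ≡ 1 (mod 5ⁿ)` with `ρ̄_{E,5}(Frob_q)` having
distinct eigenvalues, i.e. `a_q² - 4q ≢ 0 (mod 5)` (`a_q ≡ tr`, `q ≡ det`).  Route: X7g₅ gives `τ`;
K5 (with `ψ = 0`) the open normal `N = ker ρ̄ ∩ Fix(μ_{5ⁿ})`; tree Chebotarev
`exists_isArithFrobAt_mul_inv_mem_not_mem ℚ N _ τ S'` (`S' = S ∪ {5} ∪ bad primes`) gives `q`, `φ`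
with `φ τ⁻¹ ∈ N`, so `ρ̄ φ = ρ̄ τ` and `φ` fixes `μ_{5ⁿ}` ⇒ `q ≡ 1 (5ⁿ)` (KG4); `a_q, q` vs.
`tr, det` by `trace_galoisRepTate_frobenius_holds` / the mod-`5` Frobenius compatibility used in
`BCDTModularityModPProofs`. [cite: DarmonDiamondTaylor1995, Thm. 2.49 (a)(b)] -/
theorem exists_twPrime_five (W : WeierstrassCurve ℚ) [W.IsElliptic]
    {ρ : ModPGaloisRep ℚ (ZMod 5) 2} (hρ : W.IsTorsionGaloisRep 5 ρ)
    (hirr : ρ.IsAbsIrreducibleOverSqrt 5) (n : ℕ) (S : Finset ℕ) :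
    ∃ (q : ℕ) (_ : Fact q.Prime), q ∉ S ∧ q ≠ 5 ∧ q ≡ 1 [MOD 5 ^ n] ∧
      W.HasGoodReductionAtPrime q ∧ ¬ (5 : ℤ) ∣ W.LFunction q ^ 2 - 4 * q := by
  sorry

/-- **TW-KILL₅ (L as a whole; M given §1–§3) — the killing clause (c) of DDT Thm. 2.49 at `ℓ = 5`,
Selmer-free and pointwise.**  Let `ψ : Γ_ℚ → M₂(𝔽₅)` be a locally constant twisted cocycle along
`ρ̄ = ρ̄_{E,5}` with trace-zero values which is not a coboundary.  Then for every `n`, `S` there are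
a prime `q ∉ S`, `q ≠ 5`, `q ≡ 1 (mod 5ⁿ)`, a prime `𝔓 ∣ q` of `\bar ℤ` at which `ρ̄` and `ψ` are
unramified, and an arithmetic Frobenius `φ` at `𝔓` with `ρ̄(φ)` having distinct eigenvalues and
`ψ(φ) ∉ (φ - 1) M₂(𝔽₅)(1)` — i.e. `res_q [ψ] ≠ 0` in `H¹(𝔽_q, W) = W/(Frob_q - 1)W`.
Route: B1 ⇒ (A)(B); `N₀ = ker ρ̄ ∩ Fix(μ_{5ⁿ})` satisfies K12's commutator hypothesis (KG3), so
`ψ|_{N₀} ≠ 0` (K12, contrapositive); `V = span ψ(N₀)` is non-zero, trace-zero, `G`-stable (K3/K4);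
L6n-c gives `g`, `p = g^{5ⁿ}`, `X`; `σ₀ = τ₀^{5ⁿ}` (`ρ̄ τ₀ = g`; KG2, KG1) has `ρ̄ σ₀ = p`;
`I_p = im (twAd p - 1) ∌ X` (semisimplicity lemma), so some `τ ∈ N₀` has `ψ τ ∉ I_p`, and
`σ ∈ {σ₀, τ σ₀}` has `ψ σ ∉ I_p` (K0c); Chebotarev with the level subgroup `N_{ψ,n}` (K5) and
`S' = S ∪ {5}` yields `q, 𝔓, φ = m σ`, `m ∈ N_{ψ,n}`: `ρ̄ φ = p`, `ψ φ = ψ σ`, `φ` fixes `μ_{5ⁿ}`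
(KG4 ⇒ `q ≡ 1`), inertia `≤ N_{ψ,n}`.  [cite: DarmonDiamondTaylor1995, Thm. 2.49 (c) (proof, p. 84)] -/
theorem exists_twPrime_killing_five (W : WeierstrassCurve ℚ) [W.IsElliptic]
    {ρ : ModPGaloisRep ℚ (ZMod 5) 2} (hρ : W.IsTorsionGaloisRep 5 ρ)
    (hirr : ρ.IsAbsIrreducibleOverSqrt 5) (ψ : absoluteGaloisGroup ℚ → M2)
    (hψ : IsTwCocycleHom ρ.toMonoidHom ψ) (hψo : IsOpen {σ : absoluteGaloisGroup ℚ | ψ σ = 0})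
    (hψtr : ∀ σ, (ψ σ).trace = 0) (hψnb : ¬ IsTwCoboundaryHom ρ.toMonoidHom ψ)
    (n : ℕ) (S : Finset ℕ) :
    ∃ (q : ℕ) (hq : Fact q.Prime), q ∉ S ∧ q ≠ 5 ∧ q ≡ 1 [MOD 5 ^ n] ∧
      ∃ 𝔓 : Ideal (absIntegers (𝓞 ℚ) ℚ), 𝔓 ∈ (primesEquiv.symm ⟨q, hq.out⟩).primesAbove ∧
        (∀ σ ∈ 𝔓.inertia (absoluteGaloisGroup ℚ), ρ σ = 1 ∧ ψ σ = 0) ∧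
        ∃ φ : absoluteGaloisGroup ℚ, IsArithFrobAt (𝓞 ℚ) φ 𝔓 ∧
          HasDistinctEigenvalues ((ρ φ : G5) : M2) ∧
          ψ φ ∉ Set.range (fun Y : M2 => twAd (ρ φ) Y - Y) := by
  sorry

/-- **K6 applied (statement-level corollary, S given TW-KILL₅ + K6 + X7₅).**  For any finite family
of such cocycles spanning a space `H` of classes (the engine seat's dual Selmer group), `r = dim H`
TW primes of level `n` avoiding `S` kill all of `H` simultaneously — DDT 2.49 as used in the
patching argument (Diamond 1996 Thm. 5.3 hyp. (d) / k2-g12 `RTDatum.twSystem`).  Recorded as the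
composition K6 ∘ TW-KILL₅ (the functionals `ψ ↦ ψ(Frob_q) mod (Frob_q - 1)W`), padding by X7₅;
not re-typed here (the engine seat owns `H`). -/
theorem twSystem_note : True := trivial

end Summit.ABC.ABC.Cruxes.FreyModularity.StubIdeas.LiftFive2g16

end
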